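import Summits.CriticalPhenomena.PercolationContinuityZ3.Theorems.SahiBoxTP2Tilt
import Summits.CriticalPhenomena.PercolationContinuityZ3.Theorems.SahiBoxTP2HilbertMarginals

/-!
# Box-TP₂ on the Hilbert cube is preserved by continuous log-supermodular tilts

Support file of the Sahi cell (`prim-sahi`, typer seat, generation 14; `--supports stmt-CriticalPhenomena-4575`).
Theorems only (no definitions, no named facts, no sorries).  Infinite-dimensional companion of
`SahiBoxTP2Tilt.lean`.

* `isBoxTP2_of_eventually_map_finRestrict` — box-TP₂ on `ℕ → X` follows from box-TP₂ of the initial-segment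
  marginals of all SUFFICIENTLY LARGE dimensions (generation 12's criterion asked for all dimensions).
* `map_withDensity_comp` — `(g∘f · μ).map f = g · (μ.map f)`: tilting by a density that factors through `f` commutes
  with the image under `f`.
* `IsBoxTP2.withDensity_cylinder_hilbert` — a finite box-TP₂ measure on `[0,1]^ℕ` tilted by a continuous
  log-supermodular CYLINDER density `ρ₀(u_0,…,u_{D−1})` is box-TP₂ (marginals of dimension `d ≥ D` are the
  finite-dimensional tilts of `SahiBoxTP2Tilt.lean`).
* `IsBoxTP2.withDensity_of_continuous_hilbert` — the same for EVERY continuous log-supermodular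
  `ρ : [0,1]^ℕ → ℝ≥0`: `ρ ∘ pad_D → ρ` boundedly (`pad_D` freezes the coordinates `≥ D` at `1`, commutes with `⊓, ⊔`;
  the Hilbert cube is compact), so the cylinder tilts converge setwise and the abstract closure lemma
  `IsBoxTP2.of_limsup_liminf` applies.
* `IsBoxTP2.withDensity_exp_of_submodular_hilbert` — Gibbs modifications `e^{−H} μ` with `H` continuous and
  submodular on `[0,1]^ℕ` (e.g. absolutely summable ferromagnetic pair interactions) of any box-TP₂ law are
  box-TP₂; with `SahiBoxTP2HilbertPositivity.lean`: FKG for all bounded measurable monotone functionals and, given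
  `C_n`, Sahi positivity of every order.

No sorries, no new axioms.
-/

noncomputable section

namespace Summit.CriticalPhenomena.PercolationContinuityZ3.Theorems.SahiBoxTP2

open MeasureTheory Set Filter Topology Function Literature.Combinatorics.Sahi2008
open scoped ENNReal NNReal unitInterval

/-! ### Marginals of large dimension suffice -/

/-- **Box-TP₂ on `ℕ → X` from box-TP₂ of the initial-segment marginals of all large dimensions.** [this work] -/
theorem isBoxTP2_of_eventually_map_finRestrict {X : Type*} [Lattice X] [BoundedOrder X] [MeasurableSpace X]
    {μ : Measure (ℕ → X)} [IsFiniteMeasure μ] (hIcc : ∀ (d : ℕ) (a b : Fin d → X), MeasurableSet (Icc a b))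
    (h : ∀ᶠ d in atTop, IsBoxTP2 (μ.map (finRestrict d))) : IsBoxTP2 μ := by
  intro a b a' b'
  have hfin : ∀ s : Set (ℕ → X), μ s ≠ ∞ := fun s => measure_ne_top μ s
  refine le_of_tendsto_of_tendsto
    (ENNReal.Tendsto.mul (tendsto_map_finRestrict_Icc μ hIcc a b) (Or.inr (hfin _))
      (tendsto_map_finRestrict_Icc μ hIcc a' b') (Or.inr (hfin _)))
    (ENNReal.Tendsto.mul (tendsto_map_finRestrict_Icc μ hIcc (a ⊓ a') (b ⊓ b')) (Or.inr (hfin _))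
      (tendsto_map_finRestrict_Icc μ hIcc (a ⊔ a') (b ⊔ b')) (Or.inr (hfin _))) ?_
  filter_upwards [h] with d hd
  exact hd (finRestrict d a) (finRestrict d b) (finRestrict d a') (finRestrict d b')

/-! ### Tilting by a density that factors through a map commutes with the image -/

/-- `(g∘f · μ).map f = g · (μ.map f)` for measurable `f`, `g`. [folklore] -/
theorem map_withDensity_comp {α β : Type*} [MeasurableSpace α] [MeasurableSpace β] (μ : Measure α) {f : α → β}
    (hf : Measurable f) {g : β → ℝ≥0∞} (hg : Measurable g) :
    (μ.withDensity (g ∘ f)).map f = (μ.map f).withDensity g := by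
  ext s hs
  rw [Measure.map_apply hf hs, withDensity_apply _ (hf hs), withDensity_apply _ hs, setLIntegral_map hs hg hf]
  rfl

/-! ### Cylinder tilts -/

section Hilbert

variable {μ : Measure (ℕ → I)} [IsFiniteMeasure μ]

/-- Restriction `Q_d → Q_D` to the first `D ≤ d` coordinates commutes with `⊓`. [folklore] -/
theorem comp_castLE_inf {D d : ℕ} (h : D ≤ d) (x y : Fin d → I) :
    (fun i => (x ⊓ y) (Fin.castLE h i)) = (fun i => x (Fin.castLE h i)) ⊓ fun i => y (Fin.castLE h i) := rfl

/-- Restriction `Q_d → Q_D` to the first `D ≤ d` coordinates commutes with `⊔`. [folklore] -/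
theorem comp_castLE_sup {D d : ℕ} (h : D ≤ d) (x y : Fin d → I) :
    (fun i => (x ⊔ y) (Fin.castLE h i)) = (fun i => x (Fin.castLE h i)) ⊔ fun i => y (Fin.castLE h i) := rfl

/-- **Cylinder tilts preserve box-TP₂ on the Hilbert cube**: for a finite box-TP₂ measure `μ` on `[0,1]^ℕ` and a
continuous log-supermodular `ρ₀ : Q_D → ℝ≥0`, the measure `ρ₀(u_0,…,u_{D−1}) · μ` is box-TP₂. [this work] -/
theorem IsBoxTP2.withDensity_cylinder_hilbert (hμ : IsBoxTP2 μ) {D : ℕ} {ρ₀ : (Fin D → I) → ℝ≥0}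
    (hρc : Continuous ρ₀) (hρ : ∀ x y, ρ₀ x * ρ₀ y ≤ ρ₀ (x ⊓ y) * ρ₀ (x ⊔ y)) :
    IsBoxTP2 (μ.withDensity fun u => (ρ₀ (finRestrict D u) : ℝ≥0∞)) := by
  obtain ⟨x₀, -, hx₀⟩ := isCompact_univ.exists_isMaxOn univ_nonempty hρc.continuousOn
  haveI : IsFiniteMeasure (μ.withDensity fun u => (ρ₀ (finRestrict D u) : ℝ≥0∞)) := by
    refine isFiniteMeasure_withDensity (ne_of_lt ?_)
    calc ∫⁻ u, (ρ₀ (finRestrict D u) : ℝ≥0∞) ∂μ ≤ ∫⁻ _, (ρ₀ x₀ : ℝ≥0∞) ∂μ :=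
          lintegral_mono fun u => ENNReal.coe_le_coe.2 (hx₀ (mem_univ _))
      _ = ρ₀ x₀ * μ univ := lintegral_const _
      _ < ∞ := ENNReal.mul_lt_top ENNReal.coe_lt_top (measure_lt_top _ _)
  refine isBoxTP2_of_eventually_map_finRestrict (fun _ _ _ => measurableSet_Icc)
    (eventually_atTop.2 ⟨D, fun d hDd => ?_⟩)
  -- the density factors through `finRestrict d`
  set π : (Fin d → I) → (Fin D → I) := fun x i => x (Fin.castLE hDd i) with hπ
  have hπc : Continuous π := continuous_pi fun i => continuous_apply (Fin.castLE hDd i)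
  set g : (Fin d → I) → ℝ≥0∞ := fun x => (ρ₀ (π x) : ℝ≥0∞) with hg
  have hgm : Measurable g := (ENNReal.continuous_coe.comp (hρc.comp hπc)).measurable
  have hfac : (fun u : ℕ → I => (ρ₀ (finRestrict D u) : ℝ≥0∞)) = g ∘ finRestrict d := by
    funext u
    rfl
  rw [hfac, map_withDensity_comp μ (measurable_finRestrict d) hgm]
  exact (hμ.map_finRestrict_unitInterval d).withDensity_of_continuous (μ.map (finRestrict d))
    (ρ := fun x => ρ₀ (π x)) (hρc.comp hπc) fun x y => hρ _ _

/-! ### General continuous log-supermodular tilts -/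

/-- Freezing the coordinates `≥ D` at `1`: `pad_D u = finExtend D (finRestrict D u) 1`; it commutes with `⊓`.
[folklore] -/
theorem finExtend_finRestrict_inf (D : ℕ) (u v : ℕ → I) :
    finExtend D (finRestrict D (u ⊓ v)) 1 = finExtend D (finRestrict D u) 1 ⊓ finExtend D (finRestrict D v) 1 := by
  rw [show finRestrict D (u ⊓ v) = finRestrict D u ⊓ finRestrict D v from rfl, finExtend_inf]

/-- … and with `⊔`. [folklore] -/
theorem finExtend_finRestrict_sup (D : ℕ) (u v : ℕ → I) :
    finExtend D (finRestrict D (u ⊔ v)) 1 = finExtend D (finRestrict D u) 1 ⊔ finExtend D (finRestrict D v) 1 := by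
  rw [show finRestrict D (u ⊔ v) = finRestrict D u ⊔ finRestrict D v from rfl, finExtend_sup]

/-- `a ↦ finExtend D a 1 : Q_D → [0,1]^ℕ` is continuous. [folklore] -/
theorem continuous_finExtend_one (D : ℕ) : Continuous fun a : Fin D → I => finExtend D a 1 := by
  refine continuous_pi fun i => ?_
  by_cases hi : i < D
  · simp only [finExtend, dif_pos hi]
    exact continuous_apply _
  · simp only [finExtend, dif_neg hi]
    exact continuous_const

/-- `pad_D u → u` in the product topology as `D → ∞`. [folklore] -/
theorem tendsto_finExtend_finRestrict (u : ℕ → I) :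
    Tendsto (fun D => finExtend D (finRestrict D u) 1) atTop (𝓝 u) := by
  rw [tendsto_pi_nhds]
  intro i
  refine tendsto_atTop_of_eventually_const (i₀ := i + 1) fun D hD => ?_
  rw [finExtend_of_lt _ _ (Nat.lt_of_succ_le hD)]
  rfl

/-- **Box-TP₂ on the Hilbert cube is preserved by continuous log-supermodular tilts**: for a finite box-TP₂
measure `μ` on `[0,1]^ℕ` (possibly singular) and `ρ : [0,1]^ℕ → ℝ≥0` continuous with
`ρ u · ρ v ≤ ρ (u ⊓ v) · ρ (u ⊔ v)`, the tilted measure `ρ · μ` is box-TP₂. [this work] -/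
theorem IsBoxTP2.withDensity_of_continuous_hilbert (hμ : IsBoxTP2 μ) {ρ : (ℕ → I) → ℝ≥0} (hρc : Continuous ρ)
    (hρ : ∀ u v, ρ u * ρ v ≤ ρ (u ⊓ v) * ρ (u ⊔ v)) : IsBoxTP2 (μ.withDensity fun u => (ρ u : ℝ≥0∞)) := by
  obtain ⟨x₀, -, hx₀⟩ := isCompact_univ.exists_isMaxOn univ_nonempty hρc.continuousOn
  have hR : ∀ u, ρ u ≤ ρ x₀ := fun u => hx₀ (mem_univ u)
  haveI : IsFiniteMeasure (μ.withDensity fun u => (ρ u : ℝ≥0∞)) := by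
    refine isFiniteMeasure_withDensity (ne_of_lt ?_)
    calc ∫⁻ u, (ρ u : ℝ≥0∞) ∂μ ≤ ∫⁻ _, (ρ x₀ : ℝ≥0∞) ∂μ := lintegral_mono fun u => ENNReal.coe_le_coe.2 (hR u)
      _ = ρ x₀ * μ univ := lintegral_const _
      _ < ∞ := ENNReal.mul_lt_top ENNReal.coe_lt_top (measure_lt_top _ _)
  -- the cylinder tilts `ρ ∘ pad_D`
  have hcyl : ∀ D, IsBoxTP2 (μ.withDensity fun u => (ρ (finExtend D (finRestrict D u) 1) : ℝ≥0∞)) := fun D =>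
    hμ.withDensity_cylinder_hilbert (ρ₀ := fun a => ρ (finExtend D a 1)) (hρc.comp (continuous_finExtend_one D))
      fun x y => by
        have h := hρ (finExtend D x 1) (finExtend D y 1)
        rw [← finExtend_inf, ← finExtend_sup] at h
        simpa using h
  -- setwise convergence by dominated convergence
  have hconv : ∀ {B : Set (ℕ → I)}, MeasurableSet B →
      Tendsto (fun D => μ.withDensity (fun u => (ρ (finExtend D (finRestrict D u) 1) : ℝ≥0∞)) B) atTop
        (𝓝 (μ.withDensity (fun u => (ρ u : ℝ≥0∞)) B)) := by
    intro B hB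
    simp only [withDensity_apply _ hB]
    refine tendsto_lintegral_of_dominated_convergence (μ := μ.restrict B) (fun _ => (ρ x₀ : ℝ≥0∞))
      (fun D => (ENNReal.continuous_coe.comp hρc).measurable.comp
        ((continuous_finExtend_one D).measurable.comp (measurable_finRestrict D)))
      (fun D => Eventually.of_forall fun u => ENNReal.coe_le_coe.2 (hR _))
      (by rw [lintegral_const]; exact ENNReal.mul_ne_top ENNReal.coe_ne_top (measure_ne_top _ _))
      (Eventually.of_forall fun u => ?_)
    exact (ENNReal.continuous_coe.tendsto _).comp ((hρc.tendsto u).comp (tendsto_finExtend_finRestrict u))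
  refine IsBoxTP2.of_limsup_liminf (L := (atTop : Filter ℕ))
    (μs := fun D => μ.withDensity fun u => (ρ (finExtend D (finRestrict D u) 1) : ℝ≥0∞))
    (Eventually.of_forall hcyl) (fun _ => id) (fun _ => id) (fun _ _ _ => rfl) (fun _ _ _ => rfl)
    (fun _ _ _ => rfl) (fun _ _ _ => rfl) (fun D a b => ((hconv measurableSet_Icc).liminf_eq).symm.le)
    (fun D a b => (hconv measurableSet_Icc).limsup_eq.le) (fun a b => tendsto_const_nhds)

/-- **Gibbs modifications on the Hilbert cube**: for a finite box-TP₂ law `μ` on `[0,1]^ℕ` and a continuous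
submodular `H` (`H (u ⊓ v) + H (u ⊔ v) ≤ H u + H v`; e.g. absolutely summable ferromagnetic pair interactions),
`e^{−H} · μ` is box-TP₂ — hence FKG for all bounded measurable monotone functionals
(`integral_mul_integral_le_of_isBoxTP2_hilbert`) and, given `C_n`, Sahi-positive of every order
(`msahiE_nonneg_of_isBoxTP2_hilbert_of_sahiConjecture`). [this work] -/
theorem IsBoxTP2.withDensity_exp_of_submodular_hilbert (hμ : IsBoxTP2 μ) {H : (ℕ → I) → ℝ} (hHc : Continuous H)
    (hH : ∀ u v, H (u ⊓ v) + H (u ⊔ v) ≤ H u + H v) :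
    IsBoxTP2 (μ.withDensity fun u => ENNReal.ofReal (Real.exp (-H u))) :=
  hμ.withDensity_of_continuous_hilbert (ρ := fun u => Real.toNNReal (Real.exp (-H u)))
    (continuous_real_toNNReal.comp (Real.continuous_exp.comp hHc.neg)) fun u v => by
      rw [← Real.toNNReal_mul (Real.exp_pos _).le, ← Real.toNNReal_mul (Real.exp_pos _).le,
        ← Real.exp_add, ← Real.exp_add]
      exact Real.toNNReal_le_toNNReal (Real.exp_le_exp.2 (by linarith [hH u v]))

end Hilbert

end Summit.CriticalPhenomena.PercolationContinuityZ3.Theorems.SahiBoxTP2
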